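import Summits.QuantumFields.YangMills.Theorems.BalabanUVNodesN19TVCurrency
import Summits.QuantumFields.YangMills.Theorems.BalabanUVNodesN19ClassSandwichRoad

/-!
# BalabanUVNodes ∕ N19 — THE EXACT CLASS-LEVEL INVARIANT BEHIND THE OBSERVABLE-UNIFORM `Spine.NE7.Core` ON COMMON CLASS SPACES IS
# MASS_cl ∧ TV_cl: necessary from the INDICATOR observables, sufficient for EVERY bounded observable with ONE constant; SHAPE_cl is strictly
# more; road (ii)'s (I)-binder follows from TV_cl directly

Cell `pub-ymgap` (HUMAN RULING D-0062, Track A), node N19 = NE7, R134 seat `pub-ymgap-dag-n19-c` (g8): door d2 of this seat's g7 census (bus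
l.16607), dag-n19-e g8's cc «WANTED if it sharpens the MS-SPLIT wording» (l.16632), and lens decomp v7 V66 (b), which DROPPED the same-`(c, r)` iff
«NE7-S_cl ⟺ `Core` for every bounded φ» as false — this file states and proves the CORRECT iff, with the widths re-booked.  Filed `--kind proof
--supports` K3⁗ `SpineGivenEndpointR13Sep` = stmt-QuantumFields-20292 `--as helper` (dag-lead WORDS-140 key map).  COUNT-NEUTRAL.  THEOREMS ONLY (0 `def`: TV_cl is SPELLED OUT as
`|(μB K τ).real S ∕ (μB K τ).real univ − (μA K τ).real S ∕ (μA K τ).real univ| ≤ ρ K` for every measurable `S` on every good class — massless classes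
read `0 − 0`; MASS_cl ∕ SHAPE_cl ∕ NE7-S_cl in p496221's `ℝ≥0∞` letters); imports this seat's `…N19TVCurrency` (one-class lemmas) + p496221
`…N19ClassSandwichRoad`; edits nothing.

SETTING (road (iii)'s).  The two runs' class pieces `μA K τ`, `μB K τ` live on the SAME class spaces `Ω K` (e.g. pushed to the unit lattice `X`,
p496221 `classSandwich_map`), ONE observable family `W_K` (`|W| ≤ B`), dressed class terms in MGF form (`DressedMGFForm.MGFForm`).  `Spine.NE7.Core`
quantifies ONE constant `c_K` per `K` for ONE pair `(P, Q)`; «observable-uniform» = `Core` for the MGF-form terms of EVERY bounded measurable observable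
family (its constant may depend on the family — necessity pins it to the mass ratio anyway).  t-UNIFORM GOODNESS (`Bad K u ⊆ Bad K t` on the window,
p497552's displayed hypothesis) is used by necessity only.

WHAT IS PROVED ([folklore] ∕ bookkeeping).
* §1 (V) in MASS letters: `massSandwich_of_core_mgfForm` (ONE MGF-form observable: `Core`'s `t = 0` face = MASS_cl(vol·δ); p497552 `coreZero_of_core` is the
  `Core`-letters form) · `massSandwich_of_core_indicators` (the EMPTY indicator family = observable `0`: MASS_cl(vol·δ) verbatim, no side condition).
* §2 ★ NECESSITY `tvSandwich_of_core_indicators`: `Core … δ` for every indicator family `1_{S K}` (`0 < l₀`, `0 ≤ vol·δ`) ⇒ TV_cl with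
  `ρ_K = (e^{2vol·δ_K} − 1)∕(1 − e^{−l₀})` (the `t = 0` face pins `c_K`, the `t = l₀` face of `mgf 1_S = m + (e^{l₀} − 1)·μ(S)` pins `μ(S)∕m`).
* §3 ★★ SUFFICIENCY `core_of_mass_of_tv`: MASS_cl(r₁) ∧ TV_cl(ρ) ⇒ `Core l₀ vol T Bad P Q δ` for EVERY `B`-bounded observable family, with the MASS constant, at
  EVERY `t`, width `r₁ K + (e^{2l₀B} − 1)·ρ_K ≤ vol·δ_K` — no smallness condition, no (I)-binder, no mean-value step (TV integrates the common dressing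
  `e^{tW} ∈ [e^{−l₀B}, e^{l₀B}]`).  ★ `core_of_core_indicators` (BOOTSTRAP: the indicator cores carry every bounded observable, width
  `vol·δ_K + (e^{2l₀B} − 1)(e^{2vol·δ_K} − 1)∕(1 − e^{−l₀})`; summable `δ` stays summable).
* §4 `tvSandwich_of_shapeSandwich` (SHAPE_cl(r₂) ⇒ TV_cl(e^{2r₂} − 1): p496221's MASS × SHAPE road FACTORS through MASS × TV; the converse is FALSE,
  `N19TVCurrency.tv_not_shape_toy`) · `tvSandwich_of_classSandwich` · ★ `tiltedMeanMatching_of_tv` (TV_cl(ρ) ⇒ road (ii)'s (I)-binder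
  `TiltedMeanMatching l₀ T Bad W μA W μB (K ↦ 4B·e^{2l₀B}·ρ_K)` — N14's lane — directly, classes massless in one run included) ·
  `tvSandwich_map` (TV_cl pushes forward along measurable maps, same `ρ`; companion of p496221 `classSandwich_map`).
READING (for lens ROW MS-SPLIT ∕ V65 and beside p497552's ONE-observable necessity «`Core(W₀)` ⇒ (V) + (I)(W₀)»):
DENS_cl⁰ ⟹ NE7-S_cl ⟹ MASS ∧ SHAPE ⟹ MASS ∧ TV ⟺ {`Core` for every bounded `W`} ⟹ `Core(W₀)` ⟹ (V) + (I)(W₀) (inner window, one log).  The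
observable-uniform producer target that is NECESSARY AND SUFFICIENT is MASS_cl ∧ TV_cl: DENS ∕ SHAPE are what expansions PRODUCE ([Balaban1987RG1] (0.4): RG
images are densities), TV is what `Core` NEEDS; the gap between them is exactly a support mismatch of the two runs' class pieces.

HONEST FRAMING.  [folklore] measure ∕ real arithmetic on hypothesis SHAPES (MASS_cl, TV_cl, SHAPE_cl, `MGFForm`, `Core`, `TiltedMeanMatching`); discharges nothing;
every shape produced by nobody; nothing of Bałaban's instantiated; NE7 ∕ NE1′ NOT PRINTED as two-run statements for d = 4 and NOT proved; N19 NOT discharged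
(0∕1); K3⁗ NOT claimed; counts UNMOVED (typed 28∕28 · discharged 5∕27 · A 5∕28); one finite four-torus programme at fixed `ε` — NOT ℝ⁴, NOT OS, NOT a
mass gap, NOT Clay.  0 `def`; 0 `sorry`; standard axioms.
-/

set_option autoImplicit false

noncomputable section

open MeasureTheory ProbabilityTheory
open scoped ENNReal

namespace Summit.QuantumFields.YangMills.BalabanUVNodes.N19CoreTVInvariant

open Summit.QuantumFields.BalabanUV.T4Continuum.NE1p.DressedMGFForm (tiltedMean MGFForm TiltedMeanMatching)
open Summit.QuantumFields.BalabanUV.T4Continuum.NE1p.TiltedMeanInfluence (abs_tiltedMean_le)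
open Summit.QuantumFields.BalabanUV.T4Continuum.Spine.NE7 (Core)
open Summit.QuantumFields.YangMills.BalabanUVNodes.N19TVCurrency

/-! ## §1 (V) in MASS letters -/

section Leaf

variable {ι : Type*} [DecidableEq ι] {Ω : ℕ → Type*} [∀ K, MeasurableSpace (Ω K)]
variable {l₀ vol B : ℝ} {T : ℕ → Finset ι} {Bad : ℕ → ℝ → Finset ι} {W : ∀ K, Ω K → ℝ}
  {μA μB : ∀ K, ι → Measure (Ω K)} {P Q : ℕ → ℝ → ι → ℝ} {r₁ r₂ ρ δ δ' : ℕ → ℝ}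

/-- **(V) IN MASS LETTERS.**  `Spine.NE7.Core` for ONE pair of MGF-form class terms (same spaces, one observable family) with t-uniform
goodness of the classes (`Bad K u ⊆ Bad K t` on the window — p497552's displayed hypothesis) gives MASS_cl(vol·δ) in p496221's `ℝ≥0∞` letters:
its `t = 0` face (p497552 `coreZero_of_core` in `Core` letters; here read on the class masses through `MGFForm.zero_eq`). [bookkeeping] -/
theorem massSandwich_of_core_mgfForm (hP : MGFForm B T W μA P) (hQ : MGFForm B T W μB Q) (h : Core l₀ vol T Bad P Q δ)
    (hBad : ∀ K (t u : ℝ), |t| ≤ l₀ → |u| ≤ l₀ → Bad K u ⊆ Bad K t) :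
    ∀ K : ℕ, ∃ c : ℝ, ∀ t : ℝ, |t| ≤ l₀ → ∀ τ ∈ T K \ Bad K t,
      ENNReal.ofReal (Real.exp (c - vol * δ K)) * μA K τ Set.univ ≤ μB K τ Set.univ ∧
        μB K τ Set.univ ≤ ENNReal.ofReal (Real.exp (c + vol * δ K)) * μA K τ Set.univ := by
  intro K
  obtain ⟨c, hc⟩ := h K
  refine ⟨c, fun t ht τ hτ => ?_⟩
  have hτT : τ ∈ T K := (Finset.mem_sdiff.mp hτ).1
  haveI := hP.finite K τ hτT; haveI := hQ.finite K τ hτT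
  have h0 : |(0 : ℝ)| ≤ l₀ := by simpa using (abs_nonneg t).trans ht
  have hτ0 : τ ∈ T K \ Bad K 0 := by
    rw [Finset.mem_sdiff] at hτ ⊢
    exact ⟨hτ.1, fun hb => hτ.2 (hBad K t 0 ht h0 hb)⟩
  have key := hc 0 h0 τ hτ0
  rw [hP.zero_eq K hτT, hQ.zero_eq K hτT] at key
  exact ennreal_sandwich_of_real (Real.exp_pos _).le (Real.exp_pos _).le key

/-- **MASS_cl FROM THE CORE OF THE TRIVIAL OBSERVABLE.**  `Core … δ` for the indicator family of the EMPTY sets (observable `0`, whose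
dressed class terms are the class masses at EVERY `t`) is MASS_cl(vol·δ) verbatim — no goodness hypothesis, no window condition. [bookkeeping] -/
theorem massSandwich_of_core_indicators (hfinA : ∀ K, ∀ τ ∈ T K, IsFiniteMeasure (μA K τ))
    (hfinB : ∀ K, ∀ τ ∈ T K, IsFiniteMeasure (μB K τ))
    (hCore : ∀ S : ∀ K, Set (Ω K), (∀ K, MeasurableSet (S K)) →
      Core l₀ vol T Bad (fun K t τ => mgf ((S K).indicator 1) (μA K τ) t)
        (fun K t τ => mgf ((S K).indicator 1) (μB K τ) t) δ) :
    ∀ K : ℕ, ∃ c : ℝ, ∀ t : ℝ, |t| ≤ l₀ → ∀ τ ∈ T K \ Bad K t,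
      ENNReal.ofReal (Real.exp (c - vol * δ K)) * μA K τ Set.univ ≤ μB K τ Set.univ ∧
        μB K τ Set.univ ≤ ENNReal.ofReal (Real.exp (c + vol * δ K)) * μA K τ Set.univ := by
  intro K
  obtain ⟨c, hc⟩ := hCore (fun K => (∅ : Set (Ω K))) (fun _ => MeasurableSet.empty) K
  refine ⟨c, fun t ht τ hτ => ?_⟩
  have hτT : τ ∈ T K := (Finset.mem_sdiff.mp hτ).1
  haveI := hfinA K τ hτT; haveI := hfinB K τ hτT
  have key := hc t ht τ hτ
  simp only [mgf_indicator_one _ MeasurableSet.empty, measureReal_empty, mul_zero, add_zero] at key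
  exact ennreal_sandwich_of_real (Real.exp_pos _).le (Real.exp_pos _).le key

/-! ## §2 Necessity: TV_cl from the cores of the indicator observables -/

/-- ★ **NECESSITY: TV_cl FROM THE CORES OF THE INDICATOR OBSERVABLES.**  Finite class pieces of the two runs on COMMON class spaces, `0 < l₀`,
`0 ≤ vol·δ`, t-uniform goodness on the window.  If `Spine.NE7.Core l₀ vol T Bad P Q δ` holds for the dressed class terms of EVERY indicator
observable family `W_K = 1_{S K}` (`S K ⊆ Ω K` measurable; the constant `c_K` may depend on the family), then on every good class the two runs'
NORMALISED class laws are close on every measurable SET: `|μB(S)∕μB(Ω) − μA(S)∕μA(Ω)| ≤ (e^{2vol·δ_K} − 1)∕(1 − e^{−l₀})` (TV_cl, reference-measure-free;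
massless classes read `0 − 0`).  Mechanism: the `t = 0` face pins `c_K` to the mass ratio within `vol·δ_K`; the `t = l₀` face of `mgf 1_S = m + (e^{l₀} − 1)·μ(S)`
then pins `μ(S)∕m` (`abs_div_sub_div_le_of_sandwiches`).  A measure SANDWICH (SHAPE_cl ∕ NE7-S_cl) does NOT follow (`N19TVCurrency.tv_not_shape_toy`). [folklore] -/
theorem tvSandwich_of_core_indicators (hfinA : ∀ K, ∀ τ ∈ T K, IsFiniteMeasure (μA K τ))
    (hfinB : ∀ K, ∀ τ ∈ T K, IsFiniteMeasure (μB K τ)) (hl₀ : 0 < l₀) (hvol : 0 ≤ vol) (hδ : ∀ K, 0 ≤ δ K)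
    (hBad : ∀ K (t u : ℝ), |t| ≤ l₀ → |u| ≤ l₀ → Bad K u ⊆ Bad K t)
    (hCore : ∀ S : ∀ K, Set (Ω K), (∀ K, MeasurableSet (S K)) →
      Core l₀ vol T Bad (fun K t τ => mgf ((S K).indicator 1) (μA K τ) t)
        (fun K t τ => mgf ((S K).indicator 1) (μB K τ) t) δ) :
    ∀ (K : ℕ) (t : ℝ), |t| ≤ l₀ → ∀ τ ∈ T K \ Bad K t, ∀ S : Set (Ω K), MeasurableSet S →
      |(μB K τ).real S / (μB K τ).real Set.univ - (μA K τ).real S / (μA K τ).real Set.univ| ≤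
        (Real.exp (2 * (vol * δ K)) - 1) / (1 - Real.exp (-l₀)) := by
  intro K t ht τ hτ S hS
  have hτT : τ ∈ T K := (Finset.mem_sdiff.mp hτ).1
  haveI := hfinA K τ hτT; haveI := hfinB K τ hτT
  set Sf : ∀ K', Set (Ω K') := Function.update (fun K' => (∅ : Set (Ω K'))) K S with hSf
  have hSK : Sf K = S := by rw [hSf, Function.update_self]
  have hSfm : ∀ K', MeasurableSet (Sf K') := fun K' => by
    by_cases hK : K' = K
    · subst hK; rw [hSK]; exact hS
    · rw [hSf, Function.update_of_ne hK]; exact MeasurableSet.empty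
  obtain ⟨c, hc⟩ := hCore Sf hSfm K
  have h0 : |(0 : ℝ)| ≤ l₀ := by rw [abs_zero]; exact hl₀.le
  have hl : |l₀| ≤ l₀ := (abs_of_pos hl₀).le
  have hgood : ∀ u, |u| ≤ l₀ → τ ∈ T K \ Bad K u := fun u hu => by
    rw [Finset.mem_sdiff] at hτ ⊢
    exact ⟨hτ.1, fun hb => hτ.2 (hBad K t u ht hu hb)⟩
  have k0 := hc 0 h0 τ (hgood 0 h0)
  have k1 := hc l₀ hl τ (hgood l₀ hl)
  simp only [hSK, mgf_indicator_one _ hS, Real.exp_zero, sub_self, zero_mul, add_zero] at k0 k1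
  have hlam : 0 < Real.exp l₀ - 1 := sub_pos.2 (Real.one_lt_exp_iff.2 hl₀)
  have hmain := abs_div_sub_div_le_of_sandwiches measureReal_nonneg measureReal_nonneg
    (measureReal_mono (Set.subset_univ S)) measureReal_nonneg (measureReal_mono (Set.subset_univ S)) hlam
    (mul_nonneg hvol (hδ K)) k0 k1
  have hconst : (Real.exp (2 * (vol * δ K)) - 1) * (1 + (Real.exp l₀ - 1)) / (Real.exp l₀ - 1) =
      (Real.exp (2 * (vol * δ K)) - 1) / (1 - Real.exp (-l₀)) := by
    have hne : Real.exp l₀ - 1 ≠ 0 := hlam.ne'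
    have hne' : 1 - Real.exp (-l₀) ≠ 0 := by
      have : Real.exp (-l₀) < 1 := Real.exp_lt_one_iff.2 (by linarith)
      linarith
    rw [div_eq_div_iff hne hne', Real.exp_neg]
    field_simp
    ring
  rw [← hconst]
  exact hmain

/-! ## §3 Sufficiency: MASS_cl ∧ TV_cl ⇒ `Core` for every bounded observable, one constant -/

/-- ★★ **SUFFICIENCY: MASS_cl ∧ TV_cl ⇒ the dressed `Spine.NE7.Core` for EVERY bounded observable family, ONE constant.**  Two runs' class
terms in MGF form with the SAME observable family `W_K` (`|W| ≤ B`) on the SAME class spaces (road (iii)'s setting); MASS_cl(r₁) in p496221's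
letters; TV_cl(ρ) of the normalised class laws on sets; then `Core l₀ vol T Bad P Q δ` for every width `vol·δ_K ≥ r₁ K + (e^{2l₀B} − 1)·ρ_K`, with
the MASS constant — for EVERY `t` of the window, with NO smallness condition, NO (I)-binder, NO mean-value step.  Mechanism: normalise both class
pieces; the dressing `e^{tW} ∈ [e^{−l₀B}, e^{l₀B}]` integrates the set-closeness into `|EB − EA| ≤ (e^{l₀B} − e^{−l₀B})·ρ`
(`abs_integral_sub_integral_le_of_tv`), whence `EB∕EA ∈ [e^{−x}, e^{x}]`, `x = (e^{2l₀B} − 1)ρ` (`ratio_sandwich_of_abs_sub_le`), times the mass ratio.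
(In content = ne1 gen 5's L¹ ledger `TiltedMeanVisibilityTwoRun` ∘ road (ii) `DressedMGFForm.core_of_mgfForm`, there with a reference measure, an
`l₀`-factor and the (I)-detour; here set-function form, direct.) [folklore] -/
theorem core_of_mass_of_tv (hP : MGFForm B T W μA P) (hQ : MGFForm B T W μB Q)
    (hM : ∀ K : ℕ, ∃ c : ℝ, ∀ t : ℝ, |t| ≤ l₀ → ∀ τ ∈ T K \ Bad K t,
      ENNReal.ofReal (Real.exp (c - r₁ K)) * μA K τ Set.univ ≤ μB K τ Set.univ ∧
        μB K τ Set.univ ≤ ENNReal.ofReal (Real.exp (c + r₁ K)) * μA K τ Set.univ)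
    (hTV : ∀ (K : ℕ) (t : ℝ), |t| ≤ l₀ → ∀ τ ∈ T K \ Bad K t, ∀ S : Set (Ω K), MeasurableSet S →
      |(μB K τ).real S / (μB K τ).real Set.univ - (μA K τ).real S / (μA K τ).real Set.univ| ≤ ρ K)
    (hw : ∀ K, r₁ K + (Real.exp (2 * (l₀ * B)) - 1) * ρ K ≤ vol * δ K) :
    Core l₀ vol T Bad P Q δ := by
  intro K
  obtain ⟨c, hc⟩ := hM K
  refine ⟨c, fun t ht τ hτ => ?_⟩
  have hτT : τ ∈ T K := (Finset.mem_sdiff.mp hτ).1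
  haveI := hP.finite K τ hτT; haveI := hQ.finite K τ hτT
  have hB : 0 ≤ B := hP.nonneg
  have hl₀ : 0 ≤ l₀ := (abs_nonneg t).trans ht
  obtain ⟨hmlo, hmhi⟩ := real_sandwich_of_ennreal (Real.exp_pos _).le (Real.exp_pos _).le (hc t ht τ hτ)
  have hPnn : 0 ≤ P K t τ := hP.nonneg' K t hτT
  set x : ℝ := (Real.exp (2 * (l₀ * B)) - 1) * ρ K with hx
  -- the sandwich with width `r₁ + x`; widened to `vol·δ` at the end
  have key : Real.exp (c - (r₁ K + x)) * P K t τ ≤ Q K t τ ∧ Q K t τ ≤ Real.exp (c + (r₁ K + x)) * P K t τ := by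
    rcases (measureReal_nonneg : 0 ≤ (μA K τ).real Set.univ).eq_or_lt with hmA0 | hmApos
    · -- massless class: both pieces vanish
      have hA0 : μA K τ = 0 :=
        Measure.measure_univ_eq_zero.1 ((measureReal_eq_zero_iff (measure_ne_top _ _)).1 hmA0.symm)
      have hmB0 : (μB K τ).real Set.univ = 0 :=
        le_antisymm (by simpa [← hmA0] using hmhi) measureReal_nonneg
      have hB0 : μB K τ = 0 :=
        Measure.measure_univ_eq_zero.1 ((measureReal_eq_zero_iff (measure_ne_top _ _)).1 hmB0)
      rw [hP.repr K t τ hτT, hQ.repr K t τ hτT, hA0, hB0]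
      simp
    · have hmBpos : 0 < (μB K τ).real Set.univ := lt_of_lt_of_le (mul_pos (Real.exp_pos _) hmApos) hmlo
      have hA0 : μA K τ Set.univ ≠ 0 := (measureReal_ne_zero_iff (measure_ne_top _ _)).1 hmApos.ne'
      have hB0 : μB K τ Set.univ ≠ 0 := (measureReal_ne_zero_iff (measure_ne_top _ _)).1 hmBpos.ne'
      set ν₁ : Measure (Ω K) := (μA K τ Set.univ)⁻¹ • μA K τ with hν₁
      set ν₂ : Measure (Ω K) := (μB K τ Set.univ)⁻¹ • μB K τ with hν₂
      haveI : IsProbabilityMeasure ν₁ :=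
        ⟨by rw [hν₁, Measure.smul_apply, smul_eq_mul, ENNReal.inv_mul_cancel hA0 (measure_ne_top _ _)]⟩
      haveI : IsProbabilityMeasure ν₂ :=
        ⟨by rw [hν₂, Measure.smul_apply, smul_eq_mul, ENNReal.inv_mul_cancel hB0 (measure_ne_top _ _)]⟩
      have hν₁S : ∀ S, ν₁.real S = (μA K τ).real S / (μA K τ).real Set.univ := fun S => by
        rw [hν₁, measureReal_ennreal_smul_apply, ENNReal.toReal_inv, ← measureReal_def, div_eq_inv_mul]
      have hν₂S : ∀ S, ν₂.real S = (μB K τ).real S / (μB K τ).real Set.univ := fun S => by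
        rw [hν₂, measureReal_ennreal_smul_apply, ENNReal.toReal_inv, ← measureReal_def, div_eq_inv_mul]
      have hTVν : ∀ S, MeasurableSet S → |ν₂.real S - ν₁.real S| ≤ ρ K := fun S hS => by
        rw [hν₁S, hν₂S]; exact hTV K t ht τ hτ S hS
      have hfm : Measurable fun ω => Real.exp (t * W K ω) := (measurable_const.mul (hP.meas K)).exp
      have htW : ∀ ω, |t * W K ω| ≤ l₀ * B := fun ω => by
        rw [abs_mul]; exact mul_le_mul ht (hP.bound K ω) (abs_nonneg _) hl₀
      have hflo : ∀ ω, Real.exp (-(l₀ * B)) ≤ Real.exp (t * W K ω) := fun ω =>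
        Real.exp_le_exp.2 (abs_le.1 (htW ω)).1
      have hfhi : ∀ ω, Real.exp (t * W K ω) ≤ Real.exp (l₀ * B) := fun ω =>
        Real.exp_le_exp.2 (abs_le.1 (htW ω)).2
      have hmM : Real.exp (-(l₀ * B)) ≤ Real.exp (l₀ * B) := Real.exp_le_exp.2 (by nlinarith)
      have hfi : ∀ (ν : Measure (Ω K)) [IsFiniteMeasure ν], Integrable (fun ω => Real.exp (t * W K ω)) ν := fun ν _ =>
        Literature.MathematicalPhysics.QuantumFieldTheory.Balaban1983to89.T4GenFunBounds.integrable_exp_mul_of_bound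
          (μ := ν) (hP.meas K).aemeasurable (ae_of_all _ (hP.bound K)) t
      have hEA : ∫ ω, Real.exp (t * W K ω) ∂ν₁ = P K t τ / (μA K τ).real Set.univ := by
        rw [hν₁, integral_smul_measure, ENNReal.toReal_inv, smul_eq_mul, hP.repr K t τ hτT, ← measureReal_def,
          div_eq_inv_mul]
        rfl
      have hEB : ∫ ω, Real.exp (t * W K ω) ∂ν₂ = Q K t τ / (μB K τ).real Set.univ := by
        rw [hν₂, integral_smul_measure, ENNReal.toReal_inv, smul_eq_mul, hQ.repr K t τ hτT, ← measureReal_def,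
          div_eq_inv_mul]
        rfl
      have hElo : ∀ (ν : Measure (Ω K)) [IsProbabilityMeasure ν], Real.exp (-(l₀ * B)) ≤ ∫ ω, Real.exp (t * W K ω) ∂ν :=
        fun ν _ => by
          have := integral_mono (integrable_const _) (hfi ν) hflo
          rwa [integral_const, smul_eq_mul, probReal_univ, one_mul] at this
      have hclose := abs_integral_sub_integral_le_of_tv hfm hflo hfhi hmM hTVν
      have hEAlo := hElo ν₁
      have hEBlo := hElo ν₂
      rw [hEA, hEB] at hclose
      rw [hEA] at hEAlo
      rw [hEB] at hEBlo
      have hrat := ratio_sandwich_of_abs_sub_le (Real.exp_pos _) hEAlo hEBlo hclose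
      have hxeq : (Real.exp (l₀ * B) - Real.exp (-(l₀ * B))) * ρ K / Real.exp (-(l₀ * B)) = x := by
        have h2 : Real.exp (2 * (l₀ * B)) = Real.exp (l₀ * B) * Real.exp (l₀ * B) := by
          rw [← Real.exp_add]; ring_nf
        rw [hx, h2, Real.exp_neg]
        field_simp
      rw [hxeq] at hrat
      have hfin := sandwich_mul_of_sandwiches hmApos.le (div_nonneg hPnn hmApos.le) ⟨hmlo, hmhi⟩ hrat
      rwa [mul_div_cancel₀ _ hmApos.ne', mul_div_cancel₀ _ hmBpos.ne'] at hfin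
  have hwK := hw K
  constructor
  · calc Real.exp (c - vol * δ K) * P K t τ ≤ Real.exp (c - (r₁ K + x)) * P K t τ :=
          mul_le_mul_of_nonneg_right (Real.exp_le_exp.2 (by linarith)) hPnn
      _ ≤ Q K t τ := key.1
  · calc Q K t τ ≤ Real.exp (c + (r₁ K + x)) * P K t τ := key.2
      _ ≤ Real.exp (c + vol * δ K) * P K t τ := mul_le_mul_of_nonneg_right (Real.exp_le_exp.2 (by linarith)) hPnn

/-! ## §4 SHAPE_cl ⇒ TV_cl (strictly), and (I) from TV_cl directly -/

/-- **SHAPE_cl ⇒ TV_cl** (so p496221's MASS × SHAPE road FACTORS through MASS × TV): a per-class measure sandwich of width `r₂ K` makes the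
normalised class laws `(e^{2r₂ K} − 1)`-close on every set (`abs_div_sub_div_le_of_sandwich_pair`).  The converse FAILS (`N19TVCurrency.tv_not_shape_toy`):
TV tolerates a support mismatch of the two runs' class pieces, a measure sandwich forces equal supports. [folklore] -/
theorem tvSandwich_of_shapeSandwich (hfinA : ∀ K, ∀ τ ∈ T K, IsFiniteMeasure (μA K τ)) (hr : ∀ K, 0 ≤ r₂ K)
    (hSh : ∀ (K : ℕ) (t : ℝ), |t| ≤ l₀ → ∀ τ ∈ T K \ Bad K t, ∃ c : ℝ,
      ENNReal.ofReal (Real.exp (c - r₂ K)) • μA K τ ≤ μB K τ ∧ μB K τ ≤ ENNReal.ofReal (Real.exp (c + r₂ K)) • μA K τ) :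
    ∀ (K : ℕ) (t : ℝ), |t| ≤ l₀ → ∀ τ ∈ T K \ Bad K t, ∀ S : Set (Ω K), MeasurableSet S →
      |(μB K τ).real S / (μB K τ).real Set.univ - (μA K τ).real S / (μA K τ).real Set.univ| ≤
        Real.exp (2 * r₂ K) - 1 := by
  intro K t ht τ hτ S _
  have hτT : τ ∈ T K := (Finset.mem_sdiff.mp hτ).1
  haveI := hfinA K τ hτT
  obtain ⟨c, hlo, hhi⟩ := hSh K t ht τ hτ
  have hs := real_sandwich_of_measure_sandwich (Real.exp_pos _).le (Real.exp_pos _).le hlo hhi S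
  have hm := real_sandwich_of_measure_sandwich (Real.exp_pos _).le (Real.exp_pos _).le hlo hhi Set.univ
  exact abs_div_sub_div_le_of_sandwich_pair measureReal_nonneg measureReal_nonneg (measureReal_mono (Set.subset_univ S))
    (hr K) hm hs

/-- **NE7-S_cl ⇒ TV_cl** (one constant per `K` a fortiori): p496221 `shapeSandwich_of_classSandwich` ∘ `tvSandwich_of_shapeSandwich`. [bookkeeping] -/
theorem tvSandwich_of_classSandwich (hfinA : ∀ K, ∀ τ ∈ T K, IsFiniteMeasure (μA K τ)) (hr : ∀ K, 0 ≤ r₂ K)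
    (hS : ∀ K : ℕ, ∃ c : ℝ, ∀ t : ℝ, |t| ≤ l₀ → ∀ τ ∈ T K \ Bad K t,
      ENNReal.ofReal (Real.exp (c - r₂ K)) • μA K τ ≤ μB K τ ∧ μB K τ ≤ ENNReal.ofReal (Real.exp (c + r₂ K)) • μA K τ) :
    ∀ (K : ℕ) (t : ℝ), |t| ≤ l₀ → ∀ τ ∈ T K \ Bad K t, ∀ S : Set (Ω K), MeasurableSet S →
      |(μB K τ).real S / (μB K τ).real Set.univ - (μA K τ).real S / (μA K τ).real Set.univ| ≤
        Real.exp (2 * r₂ K) - 1 :=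
  tvSandwich_of_shapeSandwich hfinA hr (N19ClassSandwichRoad.shapeSandwich_of_classSandwich hS)

/-- ★ **BOOTSTRAP: THE INDICATOR CORES CARRY EVERY BOUNDED OBSERVABLE.**  If `Spine.NE7.Core … δ` holds for the dressed class terms of every
indicator observable family (finite common class pieces, `0 < l₀`, `0 ≤ vol`, `0 ≤ δ`, t-uniform goodness), then it holds — with ONE constant per `K` —
for the MGF-form class terms of EVERY `B`-bounded measurable observable family, with any width
`vol·δ′_K ≥ vol·δ_K + (e^{2l₀B} − 1)·(e^{2vol·δ_K} − 1)∕(1 − e^{−l₀})` (`massSandwich_of_core_indicators` + `tvSandwich_of_core_indicators` →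
`core_of_mass_of_tv`).  Summable `δ` ⇒ summable admissible `δ′`. [folklore] -/
theorem core_of_core_indicators (hP : MGFForm B T W μA P) (hQ : MGFForm B T W μB Q) (hl₀ : 0 < l₀) (hvol : 0 ≤ vol)
    (hδ : ∀ K, 0 ≤ δ K) (hBad : ∀ K (t u : ℝ), |t| ≤ l₀ → |u| ≤ l₀ → Bad K u ⊆ Bad K t)
    (hCore : ∀ S : ∀ K, Set (Ω K), (∀ K, MeasurableSet (S K)) →
      Core l₀ vol T Bad (fun K t τ => mgf ((S K).indicator 1) (μA K τ) t)
        (fun K t τ => mgf ((S K).indicator 1) (μB K τ) t) δ)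
    (hw : ∀ K, vol * δ K + (Real.exp (2 * (l₀ * B)) - 1) * ((Real.exp (2 * (vol * δ K)) - 1) / (1 - Real.exp (-l₀))) ≤
      vol * δ' K) :
    Core l₀ vol T Bad P Q δ' :=
  core_of_mass_of_tv hP hQ (massSandwich_of_core_indicators hP.finite hQ.finite hCore)
    (tvSandwich_of_core_indicators hP.finite hQ.finite hl₀ hvol hδ hBad hCore) hw

/-- ★ **(I) FROM TV_cl DIRECTLY: `TiltedMeanMatching` of the SAME observable family on common class spaces.**  Finite class pieces, TV_cl(ρ),
`|W| ≤ B` measurable ⇒ `TiltedMeanMatching l₀ T Bad W μA W μB (K ↦ 4B·e^{2l₀B}·ρ_K)` (road (ii)'s (I)-binder; N14's lane) — per class: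
normalise (`tiltedMean_smul_measure`, n14-c) and apply `abs_tiltedMean_sub_tiltedMean_le_of_tv`; a class massless in exactly one run forces
`ρ_K ≥ 1` (the set `univ`), and tilted means are `≤ B`.  Compare SHAPE's `B(e^{2r} − 1)` (p496221 `tiltedMeanMatching_of_shapeDensity`) and
`Core`'s lin-log price (p497552 `tiltedMeanMatching_of_core`). [folklore] -/
theorem tiltedMeanMatching_of_tv (hfinA : ∀ K, ∀ τ ∈ T K, IsFiniteMeasure (μA K τ))
    (hfinB : ∀ K, ∀ τ ∈ T K, IsFiniteMeasure (μB K τ)) (hB : 0 ≤ B) (hWm : ∀ K, Measurable (W K))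
    (hWb : ∀ K ω, |W K ω| ≤ B)
    (hTV : ∀ (K : ℕ) (t : ℝ), |t| ≤ l₀ → ∀ τ ∈ T K \ Bad K t, ∀ S : Set (Ω K), MeasurableSet S →
      |(μB K τ).real S / (μB K τ).real Set.univ - (μA K τ).real S / (μA K τ).real Set.univ| ≤ ρ K) :
    TiltedMeanMatching l₀ T Bad W μA W μB fun K => 4 * B * Real.exp (2 * (l₀ * B)) * ρ K := by
  intro K t ht τ hτ s hs
  have hτT : τ ∈ T K := (Finset.mem_sdiff.mp hτ).1
  haveI := hfinA K τ hτT; haveI := hfinB K τ hτT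
  have hTV' := hTV K t ht τ hτ
  have hρ : 0 ≤ ρ K := (abs_nonneg _).trans (hTV' ∅ MeasurableSet.empty)
  have hsB : Real.exp (2 * (|s| * B)) ≤ Real.exp (2 * (l₀ * B)) :=
    Real.exp_le_exp.2 (by nlinarith [abs_nonneg s])
  have hηB : B ≤ 4 * B * Real.exp (2 * (l₀ * B)) * 1 := by
    have : (1 : ℝ) ≤ Real.exp (2 * (l₀ * B)) := Real.one_le_exp (by nlinarith [(abs_nonneg s).trans hs])
    nlinarith
  -- tilted means are bounded by `B`, and vanish on the zero measure
  have htmB : ∀ (ν : Measure (Ω K)), |tiltedMean (W K) ν s| ≤ B := fun ν => abs_tiltedMean_le (hWb K) hB s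
  have htm0 : tiltedMean (W K) (0 : Measure (Ω K)) s = 0 := by simp [tiltedMean]
  have huniv := hTV' Set.univ MeasurableSet.univ
  rcases (measureReal_nonneg : 0 ≤ (μA K τ).real Set.univ).eq_or_lt with hmA0 | hmApos
  · -- run A's piece massless
    have hA0 : μA K τ = 0 :=
      Measure.measure_univ_eq_zero.1 ((measureReal_eq_zero_iff (measure_ne_top _ _)).1 hmA0.symm)
    rcases (measureReal_nonneg : 0 ≤ (μB K τ).real Set.univ).eq_or_lt with hmB0 | hmBpos
    · have hB0 : μB K τ = 0 :=
        Measure.measure_univ_eq_zero.1 ((measureReal_eq_zero_iff (measure_ne_top _ _)).1 hmB0.symm)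
      rw [hA0, hB0, htm0, sub_self, abs_zero]; positivity
    · -- `ρ_K ≥ 1`
      rw [← hmA0, div_self hmBpos.ne'] at huniv
      simp only [div_zero, sub_zero, abs_one] at huniv
      rw [hA0, htm0, sub_zero]
      calc |tiltedMean (W K) (μB K τ) s| ≤ B := htmB _
        _ ≤ 4 * B * Real.exp (2 * (l₀ * B)) * 1 := hηB
        _ ≤ 4 * B * Real.exp (2 * (l₀ * B)) * ρ K := mul_le_mul_of_nonneg_left huniv (by positivity)
  · rcases (measureReal_nonneg : 0 ≤ (μB K τ).real Set.univ).eq_or_lt with hmB0 | hmBpos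
    · have hB0 : μB K τ = 0 :=
        Measure.measure_univ_eq_zero.1 ((measureReal_eq_zero_iff (measure_ne_top _ _)).1 hmB0.symm)
      rw [← hmB0, div_self hmApos.ne'] at huniv
      simp only [div_zero, zero_sub, abs_neg, abs_one] at huniv
      rw [hB0, htm0, zero_sub, abs_neg]
      calc |tiltedMean (W K) (μA K τ) s| ≤ B := htmB _
        _ ≤ 4 * B * Real.exp (2 * (l₀ * B)) * 1 := hηB
        _ ≤ 4 * B * Real.exp (2 * (l₀ * B)) * ρ K := mul_le_mul_of_nonneg_left huniv (by positivity)
    · -- both pieces massive: normalise and apply the one-class lemma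
      have hA0 : μA K τ Set.univ ≠ 0 := (measureReal_ne_zero_iff (measure_ne_top _ _)).1 hmApos.ne'
      have hB0 : μB K τ Set.univ ≠ 0 := (measureReal_ne_zero_iff (measure_ne_top _ _)).1 hmBpos.ne'
      set ν₁ : Measure (Ω K) := (μA K τ Set.univ)⁻¹ • μA K τ with hν₁
      set ν₂ : Measure (Ω K) := (μB K τ Set.univ)⁻¹ • μB K τ with hν₂
      haveI : IsProbabilityMeasure ν₁ :=
        ⟨by rw [hν₁, Measure.smul_apply, smul_eq_mul, ENNReal.inv_mul_cancel hA0 (measure_ne_top _ _)]⟩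
      haveI : IsProbabilityMeasure ν₂ :=
        ⟨by rw [hν₂, Measure.smul_apply, smul_eq_mul, ENNReal.inv_mul_cancel hB0 (measure_ne_top _ _)]⟩
      have hν₁S : ∀ S, ν₁.real S = (μA K τ).real S / (μA K τ).real Set.univ := fun S => by
        rw [hν₁, measureReal_ennreal_smul_apply, ENNReal.toReal_inv, ← measureReal_def, div_eq_inv_mul]
      have hν₂S : ∀ S, ν₂.real S = (μB K τ).real S / (μB K τ).real Set.univ := fun S => by
        rw [hν₂, measureReal_ennreal_smul_apply, ENNReal.toReal_inv, ← measureReal_def, div_eq_inv_mul]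
      have hTVν : ∀ S, MeasurableSet S → |ν₂.real S - ν₁.real S| ≤ ρ K := fun S hS => by
        rw [hν₁S, hν₂S]; exact hTV' S hS
      have h1 : tiltedMean (W K) ν₁ s = tiltedMean (W K) (μA K τ) s :=
        YMDAG.N14.ConvexFibreMatching.tiltedMean_smul_measure _ _ (ENNReal.inv_ne_zero.2 (measure_ne_top _ _))
          (ENNReal.inv_ne_top.2 hA0) s
      have h2 : tiltedMean (W K) ν₂ s = tiltedMean (W K) (μB K τ) s :=
        YMDAG.N14.ConvexFibreMatching.tiltedMean_smul_measure _ _ (ENNReal.inv_ne_zero.2 (measure_ne_top _ _))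
          (ENNReal.inv_ne_top.2 hB0) s
      rw [← h1, ← h2]
      calc |tiltedMean (W K) ν₂ s - tiltedMean (W K) ν₁ s| ≤ 4 * B * Real.exp (2 * (|s| * B)) * ρ K :=
            abs_tiltedMean_sub_tiltedMean_le_of_tv (hWm K) (hWb K) hTVν s
        _ ≤ 4 * B * Real.exp (2 * (l₀ * B)) * ρ K := by gcongr

/-- **TV_cl PUSHES FORWARD** along measurable maps `a K` (e.g. the unit maps `A_K`; companion of p496221 `classSandwich_map`): finest-space
TV-closeness ⇒ unit-lattice TV-closeness, same `ρ` — the unit-lattice statement is the weaker one. [folklore] -/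
theorem tvSandwich_map {X : Type*} [MeasurableSpace X] {a : ∀ K, Ω K → X} (ha : ∀ K, Measurable (a K))
    (hTV : ∀ (K : ℕ) (t : ℝ), |t| ≤ l₀ → ∀ τ ∈ T K \ Bad K t, ∀ S : Set (Ω K), MeasurableSet S →
      |(μB K τ).real S / (μB K τ).real Set.univ - (μA K τ).real S / (μA K τ).real Set.univ| ≤ ρ K) :
    ∀ (K : ℕ) (t : ℝ), |t| ≤ l₀ → ∀ τ ∈ T K \ Bad K t, ∀ S : Set X, MeasurableSet S →
      |((μB K τ).map (a K)).real S / ((μB K τ).map (a K)).real Set.univ -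
          ((μA K τ).map (a K)).real S / ((μA K τ).map (a K)).real Set.univ| ≤ ρ K := by
  intro K t ht τ hτ S hS
  simp only [map_measureReal_apply (ha K) hS, map_measureReal_apply (ha K) MeasurableSet.univ, Set.preimage_univ]
  exact hTV K t ht τ hτ _ (hS.preimage (ha K))

end Leaf

end Summit.QuantumFields.YangMills.BalabanUVNodes.N19CoreTVInvariant

end
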